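import Summits.CriticalPhenomena.CardyFormulaZ2.Theorems.CardyComplexConeDefs
import Summits.CriticalPhenomena.CardyFormulaZ2.Theorems.ParafermionPrecompact.Negative.ParafermionPrecompactFalseOfBulkNondegenerate
import Literature.Barriers.CriticalPhenomena.FKParafermionicHalfCauchyRiemann

/-!
# Vocabulary of the line `strip-anchored-vertex-normalisation` for the crux
# `CardySusyWard.ParafermionFamiliesToSLESix` (stmt-CriticalPhenomena-10814)

Route-posited objects (D-0016: `Theorems/<RouteSlug>…Defs.lean`, reviewed), VERBATIM the
`## Vocabulary` block of the checked skeleton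
`Cruxes/ParafermionFamiliesToSLESix/Lines/strip-anchored-vertex-normalisation.lean` (same bodies,
same junk values), so that the stubs of the line, which land as separate `Theorems` files, share one
set of definitions: the spin-`1/3` corner observable `G` at the four corners of a medial vertex
(over `cornerObs` of `CardyComplexConeDefs.lean` and the barrier file's clockwise table
`medialCornersAt`), interior medial vertices `IsInteriorMV`, the staggered combination `stagger`,
the wall flux `wallFlux` of the half-CR corner form out of a window, straight pieces of wall
`LocalHalfPlane` and the thin boxes `wallBox` over them; and the six STATEMENTS of the line as named
`Prop`s — `VertexCornerBridge` (S1), `HalfCRVertexRelation χ` (S2), `StaggeredVanishes` (S4),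
`VertexVanishes` (hypothesis of S6), `AnchoredWallFlux` (S5), `FluxPropagation` (S6) — VERBATIM the
texts registered by `ledger skeleton check` on stmt-CriticalPhenomena-10814, so that each stub lands as
`theorem stub_<name> : <registered signature>` in its own `Theorems` file importing this one (the
gate's `supports.stub-mismatch` rule matches name + signature text). Same idiom as the milestones
`UniformInnerEnvelope` / `ShiftStability` of `CardyComplexConeDefs.lean`. Nothing is asserted here.
-/

noncomputable section

namespace Summit.CriticalPhenomena.CardyFormulaZ2.Theorems.ParafermionFamiliesToSLESix.StripAnchored

open MeasureTheory Filter Set Metric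
open scoped Topology BigOperators
open Literature.Probability.LatticeModels (DiscreteDobrushin MedialVertex Site medialPoint medialExploration IsCorner
  zdGraph discreteDomainGraph)
open Literature.Probability.Percolation (bondPercolation half BondConfig)
open Literature.Probability.RandomPlanarGeometry (DobrushinDomain)
open Literature.Barriers.CriticalPhenomena (medialCornersAt medialVertexOf HalfCRRelationAt)
open Literature.Barriers.CriticalPhenomena.HalfCRGreen (coeff twin)
open Summit.CriticalPhenomena.CardyFormulaZ2.Cruxes.EdgePrecompact.QkzStripBoundaryArm (cornerObs UniformInnerEnvelope)
open Summit.CriticalPhenomena.CardyFormulaZ2.Theorems.ParafermionPrecompact.Negative (IsFamily VanishesOn)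

/-- The spin-`1/3` VERTEX observable of the exploration path of the discrete Dobrushin data `E`, read
at mesh `δ`, at the medial vertex `z`: `∫ passageSum (medialExploration E ω) δ (1/3) z dP_{1/2}` —
VERBATIM the integrand of the route's `WeakHolomorphy` / `ParafermionPrecompact` (there `E = Λ δ`), and
definitionally `F Λ δ z` of the Negative lemma file. (Verbatim the skeleton's `vertexObs`.) -/
def vertexObs (E : DiscreteDobrushin) (δ : ℝ) (z : MedialVertex) : ℂ :=
  ∫ ω, Literature.Probability.LatticeModels.MedialPath.passageSum (medialExploration E ω) δ (1 / 3) z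
    ∂(bondPercolation (zdGraph 2) half)

/-- The spin-`1/3` CORNER observable at the `k`-th corner (medial edge) of the medial vertex
`s(x, x + eᵢ)`, `p = (x, i)`, corners listed clockwise `NW, NE, SE, SW` by the barrier file's table
`medialCornersAt`; `cornerObs` is the corner observable of `Theorems/CardyComplexConeDefs.lean`
(sum over the traversals of the oriented medial edge of `exp (−(i/3)·winding of the polyline prefix
ending with it)`, expectation under `P_{1/2}`). (Duminil-Copin–Smirnov 2012, §8; verbatim the
skeleton's `G`.) -/
def G (E : DiscreteDobrushin) (δ : ℝ) (p : Site 2 × Fin 2) (k : Fin 4) : ℂ :=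
  cornerObs E δ (medialCornersAt p.1 p.2 k).1 (medialCornersAt p.1 p.2 k).2

/-- `p = (x, i)` indexes an INTERIOR medial vertex of `E`: the lattice edge `s(x, x + eᵢ)` is an
edge of `Ω_δ`, has no endpoint on the discrete arcs, and both faces containing it are inner faces
(the hypotheses of the half-CR vertex relation). (Verbatim the skeleton's `IsInteriorMV`.) -/
def IsInteriorMV (E : DiscreteDobrushin) (p : Site 2 × Fin 2) : Prop :=
  medialVertexOf p ∈ (discreteDomainGraph E.Ω E.δ).edgeSet ∧
  (∀ x ∈ medialVertexOf p, x ∉ E.zdArcA ∧ x ∉ E.zdArcB) ∧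
  ∀ f : Site 2, IsCorner p.1 f → IsCorner (p.1 + Pi.single p.2 1) f → E.IsInnerFace f

/-- The STAGGERED (sum-relation) combination of the four corner observables at `p`:
`G(NW) − G(NE) + G(SE) − G(SW)`. (Verbatim the skeleton's `stagger`.) -/
def stagger (E : DiscreteDobrushin) (δ : ℝ) (p : Site 2 × Fin 2) : ℂ :=
  G E δ p 0 - G E δ p 1 + G E δ p 2 - G E δ p 3

open Classical in
/-- The WALL FLUX of the corner field of `E` (read at mesh `δ`, half-CR coefficient `χ`) out of the
window `U`: the sum, over the interior medial vertices `p` with `medialPoint δ p ∈ U` and over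
their corners whose other medial vertex (`HalfCRGreen.twin`) is NOT interior, of
`coeff χ k · G(p, k)` — the wall part of the barrier file's boundary flux `halfCRFlux χ S`.
(Finite sum for bounded `Ω`; `finsum` junk `0` otherwise. Verbatim the skeleton's `wallFlux`.) -/
def wallFlux (χ : ℂ) (E : DiscreteDobrushin) (δ : ℝ) (U : Set ℂ) : ℂ :=
  ∑ᶠ p : Site 2 × Fin 2,
    if IsInteriorMV E p ∧ medialPoint δ (medialVertexOf p) ∈ U then
      ∑ k : Fin 4, (if IsInteriorMV E (twin p.1 p.2 k) then 0 else coeff χ k * G E δ p k)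
    else 0

/-- `LocalHalfPlane D w₀ n r`: near the boundary point `w₀` the Dobrushin domain `D` is EXACTLY a
half-plane with inward unit normal `n`, on the ball of radius `4r`:
`z ∈ Ω ↔ 0 < Re((z − w₀)·n̄)` for `|z − w₀| < 4r`. (Verbatim the skeleton's `LocalHalfPlane`.) -/
def LocalHalfPlane (D : DobrushinDomain) (w₀ n : ℂ) (r : ℝ) : Prop :=
  ‖n‖ = 1 ∧ 0 < r ∧ ∀ z ∈ ball w₀ (4 * r), z ∈ D.carrier ↔ 0 < ((z - w₀) * (starRingEnd ℂ) n).re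

/-- The thin box over the wall window: tangential coordinate `|Re((z − w₀)·conj(i n))| < r`,
normal coordinate `|Re((z − w₀)·n̄)| < h`. (Verbatim the skeleton's `wallBox`.) -/
def wallBox (w₀ n : ℂ) (r h : ℝ) : Set ℂ :=
  {z | |((z - w₀) * (starRingEnd ℂ) (Complex.I * n)).re| < r ∧ |((z - w₀) * (starRingEnd ℂ) n).re| < h}


/-! ## The statements of the line (registered stub signatures, verbatim) -/

/-- (S1) VERTEX–CORNER BRIDGE. For admissible data `E`, every medial vertex `z = s(x, x + eᵢ)` other
than the two `A`–`B` edges, and every reading mesh `δ > 0`: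
`2cos(π/12) · vertexObs E δ z = Σ_{k<4} G E δ (x,i) k`. PROVED:
`CardySusyWardParafermionFamiliesToSLESixVertexCornerBridge.lean` (`stub_vertexCornerBridge_unfolded`).
A statement, not asserted here. -/
def VertexCornerBridge : Prop :=
  ∀ (E : DiscreteDobrushin), E.IsZdAdmissible → ∀ p : Site 2 × Fin 2, medialVertexOf p ∉ E.zdABEdges →
    ∀ δ : ℝ, 0 < δ →
      ((2 * Real.cos (Real.pi / 12) : ℝ) : ℂ) * vertexObs E δ (medialVertexOf p) = ∑ k : Fin 4, G E δ p k

/-- (S2) HALF-CR VERTEX RELATION with coefficient `χ` for the tree's corner observable: at every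
interior medial vertex of admissible data, `G(NW) − G(SE) = χ (G(NE) − G(SW))` (`HalfCRRelationAt χ`
of the barrier file; Duminil-Copin 2012, Prop. 4 at `q = 1`). A statement to be proved
(`stub_halfCRVertexRelation : ∃ χ, (χ = I ∨ χ = -I) ∧ HalfCRVertexRelation χ`), not asserted here. -/
def HalfCRVertexRelation (χ : ℂ) : Prop :=
  ∀ (E : DiscreteDobrushin), E.IsZdAdmissible → ∀ p : Site 2 × Fin 2, IsInteriorMV E p →
    ∀ δ : ℝ, 0 < δ → HalfCRRelationAt χ (fun c : Site 2 × Site 2 => cornerObs E δ c.1 c.2) p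

/-- (S4) STAGGERED VANISHING along the family `Λ` of `D`: on every compact `K ⊂ Ω`, for every
`ε > 0`, eventually in `δ`, `‖stagger (Λ δ) δ p‖ ≤ ε δ^{1/3}` for every medial vertex over `K` (the
asymptotic sum relation, pointwise). A statement (the line's open input), not asserted here. -/
def StaggeredVanishes (D : DobrushinDomain) (Λ : ℝ → DiscreteDobrushin) : Prop :=
  ∀ K : Set ℂ, IsCompact K → K ⊆ D.carrier → ∀ ε > (0:ℝ), ∀ᶠ δ in 𝓝[>] (0:ℝ),
    ∀ p : Site 2 × Fin 2, medialPoint δ (medialVertexOf p) ∈ K → ‖stagger (Λ δ) δ p‖ ≤ ε * δ ^ ((1:ℝ) / 3)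

/-- VERTEX VANISHING along the family `Λ` of `D` (the degenerate normalisation `δ^{-1/3} F_δ → 0` on
compacts): `VanishesOn Λ K` of the Negative lemma file for every compact `K ⊂ Ω` — what the typed
hypothesis `ParafermionPrecompact` says (`parafermionPrecompact_iff_vanishing`). A hypothesis of S6. -/
def VertexVanishes (D : DobrushinDomain) (Λ : ℝ → DiscreteDobrushin) : Prop :=
  ∀ K : Set ℂ, IsCompact K → K ⊆ D.carrier → VanishesOn Λ K

/-- (S5) ANCHORED WALL FLUX (the strip anchor, ∃-form): some Dobrushin domain `D`, some family `Λ`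
with the six family fields (`IsFamily`), some straight piece of wall (`LocalHalfPlane D w₀ n r`) and
some `c > 0` such that, for both coefficients `χ = ±i` and every box height `0 < h < r`, eventually
in `δ`: `c · δ^{-2/3} ≤ ‖wallFlux χ (Λ δ) δ (wallBox w₀ n r h)‖`. A statement, not asserted here. -/
def AnchoredWallFlux : Prop :=
  ∃ (D : DobrushinDomain) (Λ : ℝ → DiscreteDobrushin), IsFamily D Λ ∧
    ∃ (w₀ n : ℂ) (r : ℝ), LocalHalfPlane D w₀ n r ∧ ∃ c : ℝ, 0 < c ∧
      ∀ χ : ℂ, (χ = Complex.I ∨ χ = -Complex.I) → ∀ h : ℝ, 0 < h → h < r →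
        ∀ᶠ δ in 𝓝[>] (0:ℝ), c * δ ^ (-(2:ℝ) / 3) ≤ ‖wallFlux χ (Λ δ) δ (wallBox w₀ n r h)‖

/-- (S6) FLUX PROPAGATION (the contour argument): for `χ = ±i` with the half-CR relation, the
bridge and the uniform inner envelope, along any family `Λ` of any `D` on which the staggered
combination AND the vertex observable vanish at scale `δ^{1/3}` on compacts, the wall flux through
every straight piece of wall is `o(δ^{-2/3})`. A statement, not asserted here. -/
def FluxPropagation : Prop :=
  ∀ χ : ℂ, (χ = Complex.I ∨ χ = -Complex.I) → HalfCRVertexRelation χ → VertexCornerBridge →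
    UniformInnerEnvelope → ∀ (D : DobrushinDomain) (Λ : ℝ → DiscreteDobrushin), IsFamily D Λ →
      StaggeredVanishes D Λ → VertexVanishes D Λ → ∀ (w₀ n : ℂ) (r : ℝ), LocalHalfPlane D w₀ n r →
        ∀ η > (0:ℝ), ∃ h : ℝ, 0 < h ∧ h < r ∧
          ∀ᶠ δ in 𝓝[>] (0:ℝ), ‖wallFlux χ (Λ δ) δ (wallBox w₀ n r h)‖ ≤ η * δ ^ (-(2:ℝ) / 3)

/-! ## Definitional sanity (tiny, proved): the box contains its centre, the vertex observable is `F` -/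

/-- `vertexObs (Λ δ) δ z` IS the Negative lemma file's `F Λ δ z` (by `rfl`). -/
theorem vertexObs_eq_F (Λ : ℝ → DiscreteDobrushin) (δ : ℝ) (z : MedialVertex) :
    vertexObs (Λ δ) δ z = Summit.CriticalPhenomena.CardyFormulaZ2.Theorems.ParafermionPrecompact.Negative.F Λ δ z :=
  rfl

/-- The wall box of positive size contains its centre `w₀` (registered sanity statement
`stub_defsSanity`, so that this vocabulary file can land under `--supports`). -/
theorem stub_defsSanity : ∀ (w₀ n : ℂ) (r h : ℝ), 0 < r → 0 < h → w₀ ∈ wallBox w₀ n r h := by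
  intro w₀ n r h hr hh
  simp [wallBox, hr, hh]


/-! ## Vocabulary of skeleton r4 (lead c2, 2026-08-16): the boundary first-moment identity

The line's reshaped skeleton (`Cruxes/ParafermionFamiliesToSLESix/Lines/strip_anchored_vertex_normalisation.lean`,
r4) replaces the local flux propagation (S6 + the staggered-mode stub S4) by the GLOBAL conj-weighted Green
identity `Σ_{p ∈ S} conj(ẑ_p)·halfCRForm i p F = ((1+i)/4)·Σ_{(p,k) internal} F + Σ_{(p,k) wall} conj(ẑ_p)·coeff_k·F`
summed over `S_max` = the RANDOM medial vertices with both faces inner (where the half-CR relation holds).  The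
objects below are VERBATIM the `## Vocabulary of r4` block of that skeleton (same bodies, same junk values), so that
its stubs `stub_momentIdentity`, `stub_anchorMoment_of_IP`, `stub_totalSmall_of_UIE` land as separate `Theorems`
files over one set of definitions.  Nothing is asserted here. -/

/-- `p = (x, i)` indexes a RANDOM medial vertex of `E` with both faces inner: the lattice edge `s(x, x+eᵢ)` is an
edge of `Ω_δ`, is not wired (not both endpoints on the discrete arc `A`), touches no site of the discrete arc `B`,
and both faces containing it are inner faces — exactly the medial vertices whose edge is RANDOM under
`bcBondConfig` and at which the half-CR vertex relation is claimed (`S_max`; it contains `IsInteriorMV` and the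
`A`-adjacent random layer). (Verbatim the skeleton's `IsRandomMV`.) -/
def IsRandomMV (E : DiscreteDobrushin) (p : Site 2 × Fin 2) : Prop :=
  medialVertexOf p ∈ (discreteDomainGraph E.Ω E.δ).edgeSet ∧
  ¬ (∀ x ∈ medialVertexOf p, x ∈ E.zdArcA) ∧ (∀ x ∈ medialVertexOf p, x ∉ E.zdArcB) ∧
  ∀ f : Site 2, IsCorner p.1 f → IsCorner (p.1 + Pi.single p.2 1) f → E.IsInnerFace f

/-- The medial point of the medial vertex `p` at mesh `1` (lattice units: `x + ½eᵢ`). (Verbatim the skeleton's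
`latticePos`.) -/
def latticePos (p : Site 2 × Fin 2) : ℂ := medialPoint 1 (medialVertexOf p)

open Classical in
/-- The BOUNDARY FIRST MOMENT of the corner field of `E` read at mesh `δ`: the sum over the WALL corners `(p, k)` of
`S_max` (`p` random-both-inner, its twin medial vertex across the `k`-th corner not) of
`conj(ẑ_p) · coeff i k · G(p,k)` (`coeff i = (1, -i, -1, i)` on `NW, NE, SE, SW`, the barrier file's
`HalfCRGreen.coeff`).  Finite sum for bounded `Ω`; `finsum` junk `0` otherwise. (Verbatim the skeleton's
`momentSum`.) -/
def momentSum (E : DiscreteDobrushin) (δ : ℝ) : ℂ :=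
  ∑ᶠ p : Site 2 × Fin 2, if IsRandomMV E p then
    ∑ k : Fin 4, (if IsRandomMV E (twin p.1 p.2 k) then 0 else
      (starRingEnd ℂ) (latticePos p) * coeff Complex.I k * G E δ p k)
    else 0

open Classical in
/-- The PLAIN WALL SUM `Σ_{wall (p,k)} G(p,k)` of `E` read at mesh `δ` (the once-counted boundary corners in
`Σ_{p ∈ S_max} Σ_k G(p,k)`). (Verbatim the skeleton's `wallPlainSum`.) -/
def wallPlainSum (E : DiscreteDobrushin) (δ : ℝ) : ℂ :=
  ∑ᶠ p : Site 2 × Fin 2, if IsRandomMV E p then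
    ∑ k : Fin 4, (if IsRandomMV E (twin p.1 p.2 k) then 0 else G E δ p k) else 0

open Classical in
/-- The TOTAL VERTEX OBSERVABLE over `S_max`: `Σ_{p random-both-inner} vertexObs E δ (medialVertexOf p)`.
(Verbatim the skeleton's `totalVertexSum`.) -/
def totalVertexSum (E : DiscreteDobrushin) (δ : ℝ) : ℂ :=
  ∑ᶠ p : Site 2 × Fin 2, if IsRandomMV E p then vertexObs E δ (medialVertexOf p) else 0

/-- Definitional sanity (tiny, proved): the lattice position of the horizontal medial vertex at the origin is `1/2`
(registered sanity statement `stub_defsSanity_r4`, so that this vocabulary block can land under `--supports`). -/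
theorem stub_defsSanity_r4 : latticePos ((0 : Site 2), (0 : Fin 2)) = 1 / 2 := by
  simp only [latticePos, medialVertexOf, Literature.Probability.LatticeModels.medialPoint_mk,
    Literature.Probability.LatticeModels.meshPoint]
  apply Complex.ext <;> simp [Literature.Probability.LatticeModels.Site.toComplex]

end Summit.CriticalPhenomena.CardyFormulaZ2.Theorems.ParafermionFamiliesToSLESix.StripAnchored

end
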